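import Mathlib
import Literature.Analysis.FluidPDE.AncientSimilarityVorticity
import Literature.Analysis.FluidPDE.VorticityCalculus
import Literature.Analysis.FluidPDE.DipolePotentialFlow
import Summits.NavierStokesRegularity.NavierStokesRegularity.Theorems.ThreadingFluxPlatonicDefs
import HarnessLib

/-!
# Crux `PoloidalLiouville` (stmt-NavierStokesRegularity-1222, wall W1), crux idea «platonic-germ-sieve» (ns-idea-15 g11, critic V27):
# THE BRACKET IDENTITY — the linearised threading constraint at a potential lead is the Poisson bracket

Support file (`--supports stmt-NavierStokesRegularity-1222`, helper; cell `ns-wall-extremal`, width hand ns-wall-eng-7 g10; 0 kit).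
This is the custodian's RESULTS v7 §7 (v) item «Lean: … the identity of §4 [is a] formalizable statement»
(`Cruxes/PoloidalLiouville/PlatonicSieveResults.md` §4): for a potential field `a = ∇h` and an UNTHREADED field `v`
(`⟪y, curl v y⟫ = 0` near `x`) with vorticity `ω = curl v`,

  `⟪x, curl (ω × ∇h) (x)⟫ = −⟪ω(x), ∇(y ↦ ⟪y, ∇h y⟫)(x)⟫`            (★ `inner_curl_cross_curl_gradient`)

— no harmonicity of `h` and no `div v = 0` are needed (the `Δh·⟪x, ω⟫` term dies on unthreadedness, `div ω = 0` always; the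
general identity WITH those two terms is `inner_curl_cross_curl_gradient_general`).  For `h` satisfying Euler's relation
`⟪y, ∇h y⟫ = m·h y` (e.g. a solid harmonic of degree `m`) the right-hand side is `−m·⟪ω x, ∇h x⟫` (`…_of_euler`), and when the
vorticity is toroidal at `x`, `ω x = ∇T x × x`, it is the loop/Poisson bracket `−m·⟪x, ∇h x × ∇T x⟫` of the tree (`…_eq_bracket`).
The cascade's own form — RESULTS §4 verbatim, «x·curl[(∇h·∇)v_T + (v_T·∇)∇h] = −m·x·(∇h × ∇T)» — is ★ `inner_curl_convective_pair_eq_bracket`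
(`v ∈ C²`, `h ∈ C³`): pointwise `(∇h·∇)v + (v·∇)∇h = ∇⟪∇h, v⟫ + ω × ∇h` (`convective_pair_eq`: Schwarz for `D(∇h)` and «the skew part
of `Dv` is `ω×`»), and curls of `C²` gradients vanish (`curl_convective_pair_eq`, via `curl_gradient_eq_zero_holds`).  Ingredients, all
BY NAME from the Literature vector calculus: `curl_cross_apply` (curl of a cross product), `divergence_curl_eq_zero_holds`,
`divergence_gradient`, `curl_gradient_eq_zero_holds`, `hasFDerivAt_gradient`, `hasFDerivAt_cross`, `curl_add`, Mathlib's `HasFDerivAt.inner`.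

READING for the card: together with `ThreadingFluxPlatonicSelectionLemma.lean` (`Platonic.selectionLemma`, every degree) this is the
SELECTION STEP of every level of the sieve in the kernel: «the first test a potential lead ∇h applies to a vortical jet is the bracket
{h, T}, and the bracket with an O-invariant harmonic selects exactly T ∈ ℝ·h».  The cascade bookkeeping («first contact») and part (ii)
of the UNIFORM-MECHANISM CONJECTURE remain the custodian's exact engine; nothing here is an NS statement.

HONEST FRAME: pointwise vector calculus, information-grade, strictly below W1; W1 movement 0; `OctahedralCentreRigidity`,
`PoloidalLiouville` (1222), `UnthreadedRigidity` (27585) and NS regularity are OPEN — NOT proved.  [folklore]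
-/

-- the summit and its single sub-problem share the name (CONVENTIONS §1)
set_option linter.dupNamespace false

noncomputable section

namespace Summit.NavierStokesRegularity.NavierStokesRegularity.Theorems.PoloidalLiouville.Platonic

open scoped RealInnerProductSpace Topology
open Filter Set
open Literature.Analysis.FluidPDE
open Summit.NavierStokesRegularity.NavierStokesRegularity.Theorems.PoloidalLiouville.CentreJet (E3)

/-! ### Calculus of the threading function `y ↦ ⟪y, F y⟫` -/

/-- `D(y ↦ ⟪y, F y⟫)(x)[w] = ⟪w, F x⟫ + ⟪x, DF(x) w⟫` for `F` differentiable at `x`. [folklore] -/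
theorem fderiv_inner_id_apply {F : E3 → E3} {x : E3} (hF : DifferentiableAt ℝ F x) (w : E3) :
    fderiv ℝ (fun y : E3 => ⟪y, F y⟫) x w = ⟪w, F x⟫ + ⟪x, fderiv ℝ F x w⟫ := by
  have h : HasFDerivAt (fun y : E3 => ⟪y, F y⟫)
      ((fderivInnerCLM ℝ (x, F x)).comp ((ContinuousLinearMap.id ℝ E3).prod (fderiv ℝ F x))) x :=
    (hasFDerivAt_id x).inner ℝ hF.hasFDerivAt
  rw [h.fderiv]
  simp only [ContinuousLinearMap.comp_apply, ContinuousLinearMap.prod_apply, ContinuousLinearMap.id_apply, fderivInnerCLM_apply]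
  exact add_comm _ _

/-- `⟪u, ∇(y ↦ ⟪y, F y⟫)(x)⟫ = ⟪u, F x⟫ + ⟪x, DF(x) u⟫` for `F` differentiable at `x`. [folklore] -/
theorem inner_gradient_inner_id {F : E3 → E3} {x : E3} (hF : DifferentiableAt ℝ F x) (u : E3) :
    ⟪u, gradient (fun y : E3 => ⟪y, F y⟫) x⟫ = ⟪u, F x⟫ + ⟪x, fderiv ℝ F x u⟫ := by
  rw [real_inner_comm, gradient, InnerProductSpace.toDual_symm_apply, fderiv_inner_id_apply hF]

/-- UNTHREADEDNESS DIFFERENTIATED: if `⟪y, F y⟫ = 0` on a neighbourhood of `x` and `F` is differentiable at `x`, then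
`⟪w, F x⟫ + ⟪x, DF(x) w⟫ = 0` for every `w`. [folklore] -/
theorem inner_add_inner_fderiv_eq_zero_of_unthreaded {F : E3 → E3} {x : E3} (hF : DifferentiableAt ℝ F x) {U : Set E3}
    (hU : U ∈ 𝓝 x) (h0 : ∀ y ∈ U, ⟪y, F y⟫ = 0) (w : E3) : ⟪w, F x⟫ + ⟪x, fderiv ℝ F x w⟫ = 0 := by
  have hΦ : (fun y : E3 => ⟪y, F y⟫) =ᶠ[𝓝 x] fun _ => (0 : ℝ) :=
    Filter.eventually_of_mem hU fun y hy => h0 y hy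
  rw [← fderiv_inner_id_apply hF, hΦ.fderiv_eq]
  simp

/-! ### The bracket identity -/

/-- ★ **THE BRACKET IDENTITY** (RESULTS v7 §4, vorticity form).  `v ∈ C²`, `h ∈ C²`, `v` UNTHREADED on a neighbourhood `U` of `x`
(`⟪y, curl v y⟫ = 0` on `U`).  Then, with `ω = curl v`,
`⟪x, curl (ω × ∇h) (x)⟫ = −⟪ω x, ∇(y ↦ ⟪y, ∇h y⟫)(x)⟫`.
(`curl (ω × a) = (a·∇)ω − (div ω) a + (div a) ω − (ω·∇)a` by `curl_cross_apply`; `div ω = 0`; pairing with `x`, the `(div a)⟪x, ω⟫` term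
vanishes and `⟪x, (a·∇)ω⟫ = −⟪a, ω⟫` is unthreadedness differentiated along `a`.)  No harmonicity of `h`, no `div v = 0`. -/
theorem inner_curl_cross_curl_gradient {v : E3 → E3} {h : E3 → ℝ} (hv : ContDiff ℝ 2 v) (hh : ContDiff ℝ 2 h)
    {x : E3} {U : Set E3} (hU : U ∈ 𝓝 x) (hunthr : ∀ y ∈ U, ⟪y, curl v y⟫ = 0) :
    ⟪x, curl (fun y => cross (curl v y) (gradient h y)) x⟫ = -⟪curl v x, gradient (fun y : E3 => ⟪y, gradient h y⟫) x⟫ := by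
  have hω1 : ContDiff ℝ 1 (curl v) := contDiff_curl (n := 1) (by exact_mod_cast hv)
  have hωd : DifferentiableAt ℝ (curl v) x := (hω1.differentiable one_ne_zero) x
  have had : DifferentiableAt ℝ (gradient h) x := (hasFDerivAt_gradient hh x).differentiableAt
  have hdiv : VectorCalculus.divergence (curl v) x = 0 := divergence_curl_eq_zero_holds v hv x
  have hx0 : ⟪x, curl v x⟫ = 0 := hunthr x (mem_of_mem_nhds hU)
  have key := inner_add_inner_fderiv_eq_zero_of_unthreaded hωd hU hunthr (gradient h x)
  rw [curl_cross_apply hωd had, hdiv, zero_smul, sub_zero, inner_gradient_inner_id had,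
    inner_sub_right, inner_add_right, inner_smul_right, hx0, mul_zero, add_zero, real_inner_comm (gradient h x) (curl v x)]
  linarith

/-- **Euler form.**  If moreover `h` satisfies Euler's relation `⟪y, ∇h y⟫ = m·h y` for all `y` (every function homogeneous of degree
`m`, e.g. a solid harmonic of degree `m`), then `⟪x, curl (ω × ∇h)(x)⟫ = −m·⟪ω x, ∇h x⟫`. -/
theorem inner_curl_cross_curl_gradient_of_euler {v : E3 → E3} {h : E3 → ℝ} (hv : ContDiff ℝ 2 v) (hh : ContDiff ℝ 2 h)
    {m : ℝ} (heuler : ∀ y : E3, ⟪y, gradient h y⟫ = m * h y)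
    {x : E3} {U : Set E3} (hU : U ∈ 𝓝 x) (hunthr : ∀ y ∈ U, ⟪y, curl v y⟫ = 0) :
    ⟪x, curl (fun y => cross (curl v y) (gradient h y)) x⟫ = -(m * ⟪curl v x, gradient h x⟫) := by
  rw [inner_curl_cross_curl_gradient hv hh hU hunthr]
  have hfun : (fun y : E3 => ⟪y, gradient h y⟫) = fun y => m • h y := funext fun y => by rw [heuler, smul_eq_mul]
  have hd : DifferentiableAt ℝ h x := (hh.differentiable (by norm_num)) x
  have hgr : ∀ (f : E3 → ℝ) (w : E3), ⟪w, gradient f x⟫ = fderiv ℝ f x w := fun f w => by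
    rw [gradient, real_inner_comm, InnerProductSpace.toDual_symm_apply]
  rw [hfun, hgr, hgr, fderiv_fun_const_smul hd, FunLike.coe_smul, Pi.smul_apply, smul_eq_mul]

/-- **Bracket form** (RESULTS §4 verbatim: «the first test a potential leading jet ∇h applies to a vortical jet is the spherical
POISSON BRACKET»).  Under the hypotheses of the Euler form, if the vorticity at `x` is toroidal with potential `T`, `curl v x = ∇T x × x`,
then `⟪x, curl (ω × ∇h)(x)⟫ = −m·⟪x, ∇h x × ∇T x⟫` — the tree's loop bracket `{h, T}(x) = det(x, ∇h, ∇T)` of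
`LoopLaw.sameDegreeBracketRigidity` / `Zonal.mixedDegreeBracketRigidity` / `Platonic.selectionLemma`. -/
theorem inner_curl_cross_curl_gradient_eq_bracket {v : E3 → E3} {h T : E3 → ℝ} (hv : ContDiff ℝ 2 v) (hh : ContDiff ℝ 2 h)
    {m : ℝ} (heuler : ∀ y : E3, ⟪y, gradient h y⟫ = m * h y)
    {x : E3} {U : Set E3} (hU : U ∈ 𝓝 x) (hunthr : ∀ y ∈ U, ⟪y, curl v y⟫ = 0)
    (htor : curl v x = cross (gradient T x) x) :
    ⟪x, curl (fun y => cross (curl v y) (gradient h y)) x⟫ = -(m * ⟪x, cross (gradient h x) (gradient T x)⟫) := by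
  rw [inner_curl_cross_curl_gradient_of_euler hv hh heuler hU hunthr, htor]
  congr 2
  -- `⟪∇T × x, ∇h⟫ = ⟪x, ∇h × ∇T⟫` (cyclic symmetry of the triple product)
  simp only [cross, PiLp.inner_apply, cross_apply, RCLike.inner_apply, conj_trivial, Fin.sum_univ_three,
    Matrix.cons_val_zero, Matrix.cons_val_one, Matrix.cons_val_two, Matrix.head_cons, Matrix.tail_cons]
  ring

/-! ### The convective pair at a potential lead: `(a·∇)v + (v·∇)a = ∇⟪a, v⟫ + ω × a` -/

/-- **The convective pair against a potential field, pointwise.**  For `v` differentiable at `x` and `a = ∇h` with `h ∈ C²`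
(so that `D(∇h)(x)` is SYMMETRIC, Schwarz): `Dv(x)[∇h x] + D(∇h)(x)[v x] = ∇(y ↦ ⟪∇h y, v y⟫)(x) + (curl v x) × (∇h x)`.
This is the linearisation of `(u·∇)u = ∇(½|u|²) + (curl u) × u` at the potential flow `∇h` in the direction `v`; it is why the
cascade's constraint `x·curl[(∇h·∇)v + (v·∇)∇h]` is `x·curl(ω × ∇h)` (curls of `C²` gradients vanish, `curl_gradient_eq_zero_holds`). -/
theorem convective_pair_eq {v : E3 → E3} {h : E3 → ℝ} {x : E3} (hv : DifferentiableAt ℝ v x) (hh : ContDiff ℝ 2 h) :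
    fderiv ℝ v x (gradient h x) + fderiv ℝ (gradient h) x (v x) =
      gradient (fun y : E3 => ⟪gradient h y, v y⟫) x + cross (curl v x) (gradient h x) := by
  have hga := hasFDerivAt_gradient hh x
  have had : DifferentiableAt ℝ (gradient h) x := hga.differentiableAt
  -- symmetry of the Hessian, in gradient form: `⟪D(∇h) u, w⟫ = ⟪u, D(∇h) w⟫`
  have hsymm : ∀ u w : E3, ⟪fderiv ℝ (gradient h) x u, w⟫ = ⟪u, fderiv ℝ (gradient h) x w⟫ := by
    intro u w
    have hS : IsSymmSndFDerivAt ℝ h x := hh.contDiffAt.isSymmSndFDerivAt (by simp)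
    rw [hga.fderiv, ContinuousLinearMap.comp_apply, ContinuousLinearMap.comp_apply, ← real_inner_comm u,
      inner_toDualSymm_clm_apply, inner_toDualSymm_clm_apply, hS.eq]
  -- test against an arbitrary vector `w`
  refine ext_inner_right ℝ fun w => ?_
  have hprod : HasFDerivAt (fun y : E3 => ⟪gradient h y, v y⟫)
      ((fderivInnerCLM ℝ (gradient h x, v x)).comp ((fderiv ℝ (gradient h) x).prod (fderiv ℝ v x))) x :=
    hga.differentiableAt.hasFDerivAt.inner ℝ hv.hasFDerivAt
  have hgr : ⟪gradient (fun y : E3 => ⟪gradient h y, v y⟫) x, w⟫ = fderiv ℝ (fun y : E3 => ⟪gradient h y, v y⟫) x w := by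
    rw [gradient, InnerProductSpace.toDual_symm_apply]
  rw [inner_add_left, inner_add_left, hgr, hprod.fderiv]
  simp only [ContinuousLinearMap.comp_apply, ContinuousLinearMap.prod_apply, fderivInnerCLM_apply]
  rw [hsymm (v x) w, real_inner_comm (v x)]
  -- the antisymmetric part of `Dv(x)` is `ω ×`: `⟪Dv a, w⟫ − ⟪a, Dv w⟫ = ⟪ω × a, w⟫`, in coordinates
  set a : E3 := gradient h x with ha
  set D : E3 →L[ℝ] E3 := fderiv ℝ v x with hD
  have hw : w = ∑ j : Fin 3, w j • EuclideanSpace.single j (1 : ℝ) := by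
    conv_lhs => rw [← (EuclideanSpace.basisFun (Fin 3) ℝ).sum_repr w]
    simp
  have hav : a = ∑ j : Fin 3, a j • EuclideanSpace.single j (1 : ℝ) := by
    conv_lhs => rw [← (EuclideanSpace.basisFun (Fin 3) ℝ).sum_repr a]
    simp
  have hDw : D w = ∑ j : Fin 3, w j • D (EuclideanSpace.single j 1) := by
    conv_lhs => rw [hw]
    simp [map_sum, map_smul]
  have hDa : D a = ∑ j : Fin 3, a j • D (EuclideanSpace.single j 1) := by
    conv_lhs => rw [hav]
    simp [map_sum, map_smul]
  have hcurl : curl v x = curlCLM D := curl_eq_curlCLM v x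
  rw [hcurl, hDw, hDa]
  simp only [curlCLM, curlLM, LinearMap.coe_toContinuousLinearMap', LinearMap.coe_mk, AddHom.coe_mk, cross, cross_apply,
    PiLp.inner_apply, RCLike.inner_apply, conj_trivial, Fin.sum_univ_three, PiLp.add_apply, PiLp.smul_apply,
    smul_eq_mul, Matrix.cons_val_zero, Matrix.cons_val_one, Matrix.cons_val_two, Matrix.head_cons, Matrix.tail_cons]
  ring


/-! ### Curl form and the general (threaded) identity -/

/-- **The convective pair has the curl of `ω × ∇h`.**  For `v ∈ C²` and `h ∈ C³` (so that `⟪∇h, v⟫ ∈ C²` and curls of its gradient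
vanish, `curl_gradient_eq_zero_holds`): `curl[(∇h·∇)v + (v·∇)∇h] = curl(ω × ∇h)` at every point. -/
theorem curl_convective_pair_eq {v : E3 → E3} {h : E3 → ℝ} (hv : ContDiff ℝ 2 v) (hh : ContDiff ℝ 3 h) (x : E3) :
    curl (fun y => fderiv ℝ v y (gradient h y) + fderiv ℝ (gradient h) y (v y)) x =
      curl (fun y => cross (curl v y) (gradient h y)) x := by
  have hh2 : ContDiff ℝ 2 h := hh.of_le (by norm_num)
  have hvd : Differentiable ℝ v := hv.differentiable (by norm_num)
  -- the pair is `∇⟪∇h, v⟫ + ω × ∇h` as a function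
  have hfun : (fun y => fderiv ℝ v y (gradient h y) + fderiv ℝ (gradient h) y (v y)) =
      fun y => gradient (fun z : E3 => ⟪gradient h z, v z⟫) y + cross (curl v y) (gradient h y) :=
    funext fun y => convective_pair_eq (hvd y) hh2
  -- smoothness of the potential `⟪∇h, v⟫`
  have hgrad2 : ContDiff ℝ 2 (gradient h) :=
    (InnerProductSpace.toDual ℝ E3).symm.contDiff.comp (hh.fderiv_right (m := 2) (by norm_cast))
  have hg : ContDiff ℝ 2 (fun z : E3 => ⟪gradient h z, v z⟫) := hgrad2.inner ℝ hv
  have hω1 : ContDiff ℝ 1 (curl v) := contDiff_curl (n := 1) (by exact_mod_cast hv)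
  have hωd : DifferentiableAt ℝ (curl v) x := (hω1.differentiable one_ne_zero) x
  have had : DifferentiableAt ℝ (gradient h) x := (hgrad2.differentiable (by norm_num)) x
  have hGd : DifferentiableAt ℝ (gradient (fun z : E3 => ⟪gradient h z, v z⟫)) x := (hasFDerivAt_gradient hg x).differentiableAt
  have hXd : DifferentiableAt ℝ (fun y => cross (curl v y) (gradient h y)) x :=
    (hasFDerivAt_cross hωd.hasFDerivAt had.hasFDerivAt).differentiableAt
  rw [hfun, curl_add hGd hXd, curl_gradient_eq_zero_holds _ hg x, zero_add]

/-- ★ **THE BRACKET IDENTITY, CASCADE FORM** (RESULTS v7 §4 as printed: «x·curl[(∇h·∇)v_T + (v_T·∇)∇h] = −m·x·(∇h × ∇T)»).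
`v ∈ C²` unthreaded near `x`, `h ∈ C³` with Euler's relation `⟪y, ∇h y⟫ = m·h y`, toroidal vorticity `curl v x = ∇T x × x` at `x` ⇒
`⟪x, curl[(∇h·∇)v + (v·∇)∇h](x)⟫ = −m·⟪x, ∇h x × ∇T x⟫`. -/
theorem inner_curl_convective_pair_eq_bracket {v : E3 → E3} {h T : E3 → ℝ} (hv : ContDiff ℝ 2 v) (hh : ContDiff ℝ 3 h)
    {m : ℝ} (heuler : ∀ y : E3, ⟪y, gradient h y⟫ = m * h y)
    {x : E3} {U : Set E3} (hU : U ∈ 𝓝 x) (hunthr : ∀ y ∈ U, ⟪y, curl v y⟫ = 0)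
    (htor : curl v x = cross (gradient T x) x) :
    ⟪x, curl (fun y => fderiv ℝ v y (gradient h y) + fderiv ℝ (gradient h) y (v y)) x⟫ =
      -(m * ⟪x, cross (gradient h x) (gradient T x)⟫) := by
  rw [curl_convective_pair_eq hv hh x]
  exact inner_curl_cross_curl_gradient_eq_bracket hv (hh.of_le (by norm_num)) heuler hU hunthr htor

/-- **The general identity (no unthreadedness).**  For `v, h ∈ C²`, with `ω = curl v`, the threading `Φ(y) = ⟪y, ω y⟫` and
`Ψ(y) = ⟪y, ∇h y⟫`:  `⟪x, curl(ω × ∇h)(x)⟫ = −⟪ω x, ∇Ψ x⟫ + DΦ(x)[∇h x] + Δh(x)·Φ(x)` — it shows exactly which two terms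
unthreadedness (`Φ ≡ 0` near `x`) removes; `div ∇h = Δh` is `divergence_gradient`. -/
theorem inner_curl_cross_curl_gradient_general {v : E3 → E3} {h : E3 → ℝ} (hv : ContDiff ℝ 2 v) (hh : ContDiff ℝ 2 h) (x : E3) :
    ⟪x, curl (fun y => cross (curl v y) (gradient h y)) x⟫ =
      -⟪curl v x, gradient (fun y : E3 => ⟪y, gradient h y⟫) x⟫
        + fderiv ℝ (fun y : E3 => ⟪y, curl v y⟫) x (gradient h x) + Laplacian.laplacian h x * ⟪x, curl v x⟫ := by
  have hω1 : ContDiff ℝ 1 (curl v) := contDiff_curl (n := 1) (by exact_mod_cast hv)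
  have hωd : DifferentiableAt ℝ (curl v) x := (hω1.differentiable one_ne_zero) x
  have had : DifferentiableAt ℝ (gradient h) x := (hasFDerivAt_gradient hh x).differentiableAt
  have hdiv : VectorCalculus.divergence (curl v) x = 0 := divergence_curl_eq_zero_holds v hv x
  rw [curl_cross_apply hωd had, hdiv, zero_smul, sub_zero, divergence_gradient hh x, inner_gradient_inner_id had,
    fderiv_inner_id_apply hωd, inner_sub_right, inner_add_right, inner_smul_right,
    real_inner_comm (gradient h x) (curl v x)]
  ring

end Summit.NavierStokesRegularity.NavierStokesRegularity.Theorems.PoloidalLiouville.Platonic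

end
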